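import Literature.NumberTheory.Sieve.FGKMT2018Prop91EDiffPointwise
import HarnessLib

/-!
# Maynard 2016, Prop. 9.1 / FGKMT 2018, Thm 6 (7.12): the `y`-difference error — counting the `s`

Source: J. Maynard, *Dense clusters of primes in subsets*, Compositio Math. 152 (2016) =
arXiv:1405.2593 [Maynard2016DenseClusters], proof of Proposition 9.1, p. 19 bottom – p. 20 top
(«Given a choice of `r ∈ 𝒟_k` and `A ∣ r`, for each prime `p ∣ A` there are `ω(p) − 1` possible
choices of which components of `s` can be a multiple of `p` … Thus the error contributes
`≪ T_k/log R · Σ_r Y_r² φ(r)/φ_ω(r)² Σ_{A∣r, A>1} (∏_{p∣A} (ω(p)−1)/(p−1)) log A`»);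
K. Ford, B. Green, S. Konyagin, J. Maynard, T. Tao, *Long gaps between primes*, JAMS 31 (2018)
[FordGreenKonyaginMaynardTao2018], Thm 6 (7.12) pp. 21–22.

This file performs the COUNTING of the `s` in the symmetrised bound `abs_ediff_le_sum_kernel` of
`FGKMT2018Prop91EDiffPointwise`: peeling one prime of `m = ∏rᵢ` at a time (the vectors `s ∈ 𝒟_k`
with `∏s = m` and `p ∣ s_{j'}` inject into those with `∏s' = m/p` via `s ↦ s/p@j'`; a matched prime
carries weight `p − 1`, a mismatched one weight `1` and at most `k − 1` positions), we get
`Σ_{s ∈ 𝒟_k, ∏s = m, p mismatched} ∏_{q∣(r,s)}(q − 1) ≤ (k − 1) ∏_{q∣m, q≠p} (q + k − 2)`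
(`sum_matchWt_le`), hence `Σ_{s, ∏s = m} log A(r,s) ∏_{q∣(r,s)}(q−1) ≤ (k−1) Σ_{p∣m} log p ∏_{q∣m, q≠p}(q+k−2)`
(`sum_log_misProd_mul_matchWt_le`) — Maynard's «`ω(p) − 1` choices» bound with `ω(p) ≤ k`.
-/

noncomputable section

open Finset Real

namespace Literature.NumberTheory.Sieve.FGKMT2018

variable {k : ℕ}

/-! ### Peeling one prime -/

/-- For `r, s ∈ 𝒟_k(𝓛)` and a prime `p` with `p ∣ rⱼ`, `p ∣ s_{j'}`: `p ∣ (r,s) ⟺ j = j'`.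
[cite: Maynard2016DenseClusters, proof of Prop. 9.1 p. 19, (9.5) («if p ∣ (r,s)»)] -/
theorem matched_iff_eq {L : Fin k → ℤ × ℤ} {B : ℕ} {R : ℝ} {r s : Fin k → ℕ}
    (hr : r ∈ dkBox L B R) (hs : s ∈ dkBox L B R) {p : ℕ} (hp : p.Prime) {j j' : Fin k}
    (hpj : p ∣ r j) (hpj' : p ∣ s j') : Matched r s p ↔ j = j' := by
  constructor
  · rintro ⟨i, hri, hsi⟩
    have hij : i = j := by
      by_contra hne
      have hg := Nat.dvd_gcd hri hpj
      rw [(coprime_apply_of_mem_dkBox hr hne).gcd_eq_one] at hg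
      exact hp.one_lt.ne' (Nat.dvd_one.1 hg)
    have hij' : i = j' := by
      by_contra hne
      have hg := Nat.dvd_gcd hsi hpj'
      rw [(coprime_apply_of_mem_dkBox hs hne).gcd_eq_one] at hg
      exact hp.one_lt.ne' (Nat.dvd_one.1 hg)
    rw [← hij, ← hij']
  · rintro rfl
    exact ⟨j, hpj, hpj'⟩

/-- Removing `p` from `rⱼ` and `s_{j'}` does not change which primes `q ≠ p` are matched.
[cite: Maynard2016DenseClusters, proof of Prop. 9.1 p. 19, (9.5)] -/
theorem matched_update_div_iff (r s : Fin k → ℕ) (j j' : Fin k) {p q : ℕ} (hp : p.Prime)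
    (hq : q.Prime) (hqp : q ≠ p) (hpj : p ∣ r j) (hpj' : p ∣ s j') :
    Matched (Function.update r j (r j / p)) (Function.update s j' (s j' / p)) q ↔ Matched r s q :=
  exists_congr fun i => and_congr (prime_dvd_update_div_iff r j hp hq hqp hpj i)
    (prime_dvd_update_div_iff s j' hp hq hqp hpj' i)

/-- **Peeling one prime off `∏_{q∣(r,s)}(q−1)`**: for `r, s ∈ 𝒟_k(𝓛)` with `∏r = ∏s = N`, `p ∣ rⱼ`,
`p ∣ s_{j'}`: `matchWt r s N = (p − 1 if j = j' else 1) · matchWt (r/p@j) (s/p@j') (N/p)`.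
[cite: Maynard2016DenseClusters, proof of Prop. 9.1 p. 19, (9.5)] -/
theorem matchWt_peel {L : Fin k → ℤ × ℤ} {B : ℕ} {R : ℝ} {r s : Fin k → ℕ}
    (hr : r ∈ dkBox L B R) (hs : s ∈ dkBox L B R) {N : ℕ} (hrN : (∏ i, r i) = N)
    {p : ℕ} (hp : p.Prime) (hpN : p ∣ N) {j j' : Fin k} (hpj : p ∣ r j) (hpj' : p ∣ s j') :
    matchWt r s N = (if j = j' then (p : ℝ) - 1 else 1) *
      matchWt (Function.update r j (r j / p)) (Function.update s j' (s j' / p)) (N / p) := by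
  have hsqN : Squarefree N := by rw [← hrN]; exact squarefree_of_mem_dkBox hr
  have hpmem : p ∈ N.primeFactors := Nat.mem_primeFactors.2 ⟨hp, hpN, hsqN.ne_zero⟩
  unfold matchWt
  rw [← Finset.mul_prod_erase _ _ hpmem, primeFactors_div_of_squarefree hsqN hp hpN]
  congr 1
  · rw [if_congr (matched_iff_eq hr hs hp hpj hpj') rfl rfl]
  · refine Finset.prod_congr rfl fun q hq => ?_
    have hq' := Finset.mem_erase.1 hq
    rw [if_congr (matched_update_div_iff r s j j' hp (Nat.prime_of_mem_primeFactors hq'.2) hq'.1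
      hpj hpj') rfl rfl]

/-- `Σ_{j'} (a if j = j' else b) = a + (k − 1) b`. [cite: Maynard2016DenseClusters, proof of Prop. 9.1 p. 19 («ω(p) − 1 possible choices»)] -/
theorem sum_ite_eq_add (j : Fin k) (a b : ℝ) :
    ∑ j' : Fin k, (if j = j' then a else b) = a + ((k : ℝ) - 1) * b := by
  have h : ∀ j' : Fin k, (if j = j' then a else b) = b + (if j = j' then a - b else 0) := by
    intro j'; split_ifs <;> ring
  simp_rw [h]
  rw [Finset.sum_add_distrib, Finset.sum_const, Finset.card_univ, Fintype.card_fin, nsmul_eq_mul,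
    Finset.sum_ite_eq, if_pos (Finset.mem_univ j)]
  ring

/-! ### The count -/

/-- **Counting the `s` (upper bound)**: for `r ∈ 𝒟_k(𝓛)` with `∏rᵢ = N` and a set `P` of primes of
`N` forced to be mismatched, `Σ_{s ∈ 𝒟_k, ∏s = N, P mismatched} ∏_{q∣(r,s)}(q−1) ≤ (k−1)^{#P}
∏_{q∣N, q∉P}(q + k − 2)` — each prime of `N` sits at one of at most `k − 1` wrong positions (weight `1`)
or at the right one (weight `q − 1`). Maynard has the sharper `ω(q) − 1` for `k − 1`.
[cite: Maynard2016DenseClusters, proof of Prop. 9.1 p. 19 («for each prime p ∣ A there are ω(p) − 1 possible choices of which components of s can be a multiple of p»)] -/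
theorem sum_matchWt_le (hk : 1 ≤ k) {L : Fin k → ℤ × ℤ} {B : ℕ} {R : ℝ} :
    ∀ (N : ℕ) (r : Fin k → ℕ), r ∈ dkBox L B R → (∏ i, r i) = N → ∀ P ⊆ N.primeFactors,
      ∑ s ∈ (dkBox L B R).filter (fun s => (∏ i, s i) = N ∧ ∀ p ∈ P, ¬ Matched r s p),
          matchWt r s N ≤
        ((k : ℝ) - 1) ^ #P * ∏ q ∈ N.primeFactors \ P, ((q : ℝ) + k - 2) := by
  classical
  have hk1 : (0 : ℝ) ≤ (k : ℝ) - 1 := by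
    have : (1 : ℝ) ≤ k := by exact_mod_cast hk
    linarith
  intro N
  induction N using Nat.strong_induction_on with
  | _ N ih =>
    intro r hr hrN P hP
    by_cases hN1 : N = 1
    · subst hN1
      have hP0 : P = ∅ := Finset.subset_empty.1 (by rwa [Nat.primeFactors_one] at hP)
      subst hP0
      have hr1 : r = fun _ => 1 := funext fun i => Nat.dvd_one.1 (by
        rw [← hrN]; exact Finset.dvd_prod_of_mem r (Finset.mem_univ i))
      have hset : (dkBox L B R).filter (fun s => (∏ i, s i) = 1 ∧ ∀ p ∈ (∅ : Finset ℕ), ¬ Matched r s p)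
          ⊆ {fun _ => 1} := by
        intro s hs
        rw [Finset.mem_singleton]
        obtain ⟨-, hs1, -⟩ := Finset.mem_filter.1 hs
        exact funext fun i => Nat.dvd_one.1 (by
          rw [← hs1]; exact Finset.dvd_prod_of_mem s (Finset.mem_univ i))
      refine (Finset.sum_le_sum_of_subset_of_nonneg hset fun s _ _ => matchWt_nonneg r s 1).trans ?_
      rw [Finset.sum_singleton, Finset.card_empty, pow_zero, one_mul, Nat.primeFactors_one,
        Finset.empty_sdiff, Finset.prod_empty]
      unfold matchWt
      rw [Nat.primeFactors_one, Finset.prod_empty]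
    · -- peel the least prime `p` of `N`
      have hN0 : 0 < N := by
        rw [← hrN]; exact Finset.prod_pos fun i _ => one_le_of_mem_dkBox hr i
      have hp : N.minFac.Prime := Nat.minFac_prime hN1
      set p := N.minFac with hpdef
      have hpN : p ∣ N := Nat.minFac_dvd N
      have hsqN : Squarefree N := by rw [← hrN]; exact squarefree_of_mem_dkBox hr
      have hpmem : p ∈ N.primeFactors := Nat.mem_primeFactors.2 ⟨hp, hpN, hsqN.ne_zero⟩
      have hpr : p ∣ ∏ i, r i := by rw [hrN]; exact hpN
      obtain ⟨j, -, hpj⟩ := ((Nat.prime_iff.1 hp).dvd_finsetProd_iff _).1 hpr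
      have hr' := update_div_mem_dkBox hr j hpj
      have hr'N : (∏ i, Function.update r j (r j / p) i) = N / p :=
        (Nat.div_eq_of_eq_mul_right hp.pos (by rw [mul_prod_update_div r j hpj, hrN])).symm
      have hpF' : (N / p).primeFactors = N.primeFactors.erase p :=
        primeFactors_div_of_squarefree hsqN hp hpN
      have hP' : P.erase p ⊆ (N / p).primeFactors := by
        rw [hpF']; exact Finset.erase_subset_erase _ hP
      have IH := ih (N / p) (Nat.div_lt_self hN0 hp.one_lt) _ hr' hr'N (P.erase p) hP'
      set S := (dkBox L B R).filter (fun s => (∏ i, s i) = N ∧ ∀ q ∈ P, ¬ Matched r s q) with hS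
      set S' := (dkBox L B R).filter (fun s => (∏ i, s i) = N / p ∧
        ∀ q ∈ P.erase p, ¬ Matched (Function.update r j (r j / p)) s q) with hS'
      set r' := Function.update r j (r j / p) with hr'def
      -- the per-position constant
      set c : Fin k → ℝ := fun j' =>
        if p ∈ P then (if j = j' then 0 else 1) else (if j = j' then (p : ℝ) - 1 else 1) with hc
      have hc0 : ∀ j', 0 ≤ c j' := by
        intro j'
        have h2 : (2 : ℝ) ≤ p := by exact_mod_cast hp.two_le
        simp only [hc]
        split_ifs <;> linarith
      -- (1) at least one position of `s` carries `p`
      have hone : ∀ s ∈ S, matchWt r s N ≤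
          ∑ j' : Fin k, (if p ∣ s j' then matchWt r s N else 0) := by
        intro s hs
        obtain ⟨hsbox, hsN, -⟩ := Finset.mem_filter.1 hs
        have hps : p ∣ ∏ i, s i := by rw [hsN]; exact hpN
        obtain ⟨j₀, -, hj₀⟩ := ((Nat.prime_iff.1 hp).dvd_finsetProd_iff _).1 hps
        refine le_trans (le_of_eq (by rw [if_pos hj₀])) (Finset.single_le_sum (f := fun j' =>
          if p ∣ s j' then matchWt r s N else 0) (fun j' _ => ?_) (Finset.mem_univ j₀))
        split_ifs
        · exact matchWt_nonneg r s N
        · exact le_rfl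
      -- (2) for a fixed position `j'`: inject `s ↦ s/p@j'`
      have hstep : ∀ j' : Fin k,
          ∑ s ∈ S, (if p ∣ s j' then matchWt r s N else 0) ≤
            c j' * ∑ s' ∈ S', matchWt r' s' (N / p) := by
        intro j'
        rw [← Finset.sum_filter]
        by_cases hbad : p ∈ P ∧ j = j'
        · -- no admissible `s`: `p` would be matched
          have hempty : ∀ s ∈ S.filter (fun s => p ∣ s j'), False := by
            intro s hs
            obtain ⟨hs1, hpsj'⟩ := Finset.mem_filter.1 hs
            obtain ⟨-, -, hcon⟩ := Finset.mem_filter.1 hs1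
            exact hcon p hbad.1 ⟨j, hpj, hbad.2 ▸ hpsj'⟩
          rw [Finset.sum_eq_zero fun s hs => (hempty s hs).elim]
          exact mul_nonneg (hc0 j') (Finset.sum_nonneg fun s' _ => matchWt_nonneg _ _ _)
        · have hcj' : c j' = if j = j' then (p : ℝ) - 1 else 1 := by
            simp only [hc]
            by_cases hpP : p ∈ P
            · have hjj : j ≠ j' := fun h => hbad ⟨hpP, h⟩
              rw [if_pos hpP, if_neg hjj, if_neg hjj]
            · rw [if_neg hpP]
          -- pointwise peel
          have hpt : ∀ s ∈ S.filter (fun s => p ∣ s j'), matchWt r s N =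
              c j' * matchWt r' (Function.update s j' (s j' / p)) (N / p) := by
            intro s hs
            obtain ⟨hs1, hpsj'⟩ := Finset.mem_filter.1 hs
            obtain ⟨hsbox, -, -⟩ := Finset.mem_filter.1 hs1
            rw [hcj', matchWt_peel hr hsbox hrN hp hpN hpj hpsj']
          rw [Finset.sum_congr rfl hpt, ← Finset.mul_sum]
          refine mul_le_mul_of_nonneg_left ?_ (hc0 j')
          -- injectivity of `s ↦ s/p@j'` on the fibre
          have hinj : ∀ s ∈ S.filter (fun s => p ∣ s j'), ∀ t ∈ S.filter (fun s => p ∣ s j'),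
              Function.update s j' (s j' / p) = Function.update t j' (t j' / p) → s = t := by
            intro s hs t ht hst
            have hps := (Finset.mem_filter.1 hs).2
            have hpt' := (Finset.mem_filter.1 ht).2
            have h1 : s = Function.update (Function.update s j' (s j' / p)) j'
                (Function.update s j' (s j' / p) j' * p) := by
              rw [Function.update_idem, Function.update_self, Nat.div_mul_cancel hps,
                Function.update_eq_self]
            have h2 : t = Function.update (Function.update t j' (t j' / p)) j'
                (Function.update t j' (t j' / p) j' * p) := by
              rw [Function.update_idem, Function.update_self, Nat.div_mul_cancel hpt',
                Function.update_eq_self]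
            rw [h1, h2, hst]
          rw [← Finset.sum_image (g := fun s => Function.update s j' (s j' / p))
            (f := fun s' => matchWt r' s' (N / p)) hinj]
          refine Finset.sum_le_sum_of_subset_of_nonneg ?_ fun s' _ _ => matchWt_nonneg _ _ _
          -- the image lies in `S'`
          intro s' hs'
          obtain ⟨s, hs, rfl⟩ := Finset.mem_image.1 hs'
          obtain ⟨hs1, hpsj'⟩ := Finset.mem_filter.1 hs
          obtain ⟨hsbox, hsN, hcon⟩ := Finset.mem_filter.1 hs1
          refine Finset.mem_filter.2 ⟨update_div_mem_dkBox hsbox j' hpsj', ?_, ?_⟩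
          · exact (Nat.div_eq_of_eq_mul_right hp.pos
              (by rw [mul_prod_update_div s j' hpsj', hsN])).symm
          · intro q hq hmq
            have hq' := Finset.mem_erase.1 hq
            have hqprime : q.Prime := Nat.prime_of_mem_primeFactors (hP hq'.2)
            exact hcon q hq'.2 ((matched_update_div_iff r s j j' hp hqprime hq'.1 hpj hpsj').1 hmq)
      -- (3) the sum of the constants
      have hcsum : ∑ j' : Fin k, c j' = if p ∈ P then (k : ℝ) - 1 else (p : ℝ) + k - 2 := by
        simp only [hc]
        split_ifs with hpP
        · rw [sum_ite_eq_add]; ring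
        · rw [sum_ite_eq_add]; ring
      -- assemble
      calc ∑ s ∈ S, matchWt r s N
          ≤ ∑ s ∈ S, ∑ j' : Fin k, (if p ∣ s j' then matchWt r s N else 0) :=
            Finset.sum_le_sum hone
        _ = ∑ j' : Fin k, ∑ s ∈ S, (if p ∣ s j' then matchWt r s N else 0) := Finset.sum_comm
        _ ≤ ∑ j' : Fin k, c j' * ∑ s' ∈ S', matchWt r' s' (N / p) := Finset.sum_le_sum fun j' _ => hstep j'
        _ = (∑ j' : Fin k, c j') * ∑ s' ∈ S', matchWt r' s' (N / p) := by rw [Finset.sum_mul]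
        _ ≤ (∑ j' : Fin k, c j') * (((k : ℝ) - 1) ^ #(P.erase p) *
              ∏ q ∈ (N / p).primeFactors \ P.erase p, ((q : ℝ) + k - 2)) :=
            mul_le_mul_of_nonneg_left IH (Finset.sum_nonneg fun j' _ => hc0 j')
        _ = ((k : ℝ) - 1) ^ #P * ∏ q ∈ N.primeFactors \ P, ((q : ℝ) + k - 2) := by
            rw [hcsum, hpF']
            by_cases hpP : p ∈ P
            · rw [if_pos hpP, Finset.card_erase_of_mem hpP]
              have hset : N.primeFactors.erase p \ P.erase p = N.primeFactors \ P := by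
                ext q
                simp only [Finset.mem_sdiff, Finset.mem_erase]
                constructor
                · rintro ⟨⟨hqp, hqN⟩, hnot⟩
                  exact ⟨hqN, fun hqP => hnot ⟨hqp, hqP⟩⟩
                · rintro ⟨hqN, hqP⟩
                  exact ⟨⟨fun h => hqP (h ▸ hpP), hqN⟩, fun h => hqP h.2⟩
              rw [hset]
              have hcard : 1 ≤ #P := Finset.card_pos.2 ⟨p, hpP⟩
              conv_rhs => rw [← Nat.sub_add_cancel hcard, pow_succ]
              ring
            · rw [if_neg hpP, Finset.erase_eq_of_notMem hpP]
              have hset : N.primeFactors \ P = insert p (N.primeFactors.erase p \ P) := by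
                ext q
                simp only [Finset.mem_sdiff, Finset.mem_erase, Finset.mem_insert]
                constructor
                · rintro ⟨hqN, hqP⟩
                  by_cases hqp : q = p
                  · exact Or.inl hqp
                  · exact Or.inr ⟨⟨hqp, hqN⟩, hqP⟩
                · rintro (rfl | ⟨⟨-, hqN⟩, hqP⟩)
                  · exact ⟨hpmem, hpP⟩
                  · exact ⟨hqN, hqP⟩
              have hnot : p ∉ N.primeFactors.erase p \ P := by simp
              rw [hset, Finset.prod_insert hnot]
              ring

/-! ### Summing `log A` against the count -/

/-- `log A(r,s) = Σ_{p ∣ m, p ∤ (r,s)} log p`. [cite: Maynard2016DenseClusters, proof of Prop. 9.1 p. 19 («A = r/(r,s)»)] -/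
theorem log_misProd_eq_sum (r s : Fin k → ℕ) (m : ℕ) :
    Real.log (misProd r s m) = ∑ p ∈ m.primeFactors, (if Matched r s p then 0 else Real.log p) := by
  classical
  unfold misProd
  rw [Nat.cast_prod, Real.log_prod]
  · rw [Finset.sum_filter]
    refine Finset.sum_congr rfl fun p _ => ?_
    split_ifs <;> rfl
  · intro p hp
    exact_mod_cast (Nat.prime_of_mem_primeFactors (Finset.mem_filter.1 hp).1).ne_zero

/-- **`Σ_{s ∈ 𝒟_k, ∏s = ∏r} log A(r,s) ∏_{q∣(r,s)}(q−1) ≤ (k−1) Σ_{p∣m} log p ∏_{q∣m, q≠p}(q+k−2)`**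
(`m = ∏rᵢ`): Maynard's count «`∏_{p∣A}(ω(p)−1)` choices of `s`», with `ω(p) ≤ k`.
[cite: Maynard2016DenseClusters, proof of Prop. 9.1 pp. 19–20 («Σ_{A∣r, A>1} (φ(A)/A ∏_{p∣A}(ω(p)−1)/(p−1)) log A» bound)] -/
theorem sum_log_misProd_mul_matchWt_le (hk : 1 ≤ k) {L : Fin k → ℤ × ℤ} {B : ℕ} {R : ℝ}
    {r : Fin k → ℕ} (hr : r ∈ dkBox L B R) {N : ℕ} (hrN : (∏ i, r i) = N) :
    ∑ s ∈ (dkBox L B R).filter (fun s => (∏ i, s i) = N),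
        Real.log (misProd r s N) * matchWt r s N ≤
      ((k : ℝ) - 1) * ∑ p ∈ N.primeFactors, Real.log p *
        ∏ q ∈ N.primeFactors.erase p, ((q : ℝ) + k - 2) := by
  classical
  set S := (dkBox L B R).filter (fun s => (∏ i, s i) = N) with hS
  clear_value S
  have h1 : ∑ s ∈ S, Real.log (misProd r s N) * matchWt r s N =
      ∑ p ∈ N.primeFactors, Real.log p *
        ∑ s ∈ S.filter (fun s => ¬ Matched r s p), matchWt r s N := by
    calc ∑ s ∈ S, Real.log (misProd r s N) * matchWt r s N
        = ∑ s ∈ S, ∑ p ∈ N.primeFactors,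
            (if Matched r s p then 0 else Real.log p) * matchWt r s N :=
          Finset.sum_congr rfl fun s _ => by rw [log_misProd_eq_sum, Finset.sum_mul]
      _ = ∑ p ∈ N.primeFactors, ∑ s ∈ S,
            (if Matched r s p then 0 else Real.log p) * matchWt r s N := Finset.sum_comm
      _ = _ := by
          refine Finset.sum_congr rfl fun p _ => ?_
          rw [Finset.mul_sum, Finset.sum_filter]
          refine Finset.sum_congr rfl fun s _ => ?_
          split_ifs <;> simp
  rw [h1, Finset.mul_sum]
  refine Finset.sum_le_sum fun p hp => ?_
  have hlogp : 0 ≤ Real.log p :=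
    Real.log_nonneg (by exact_mod_cast (Nat.prime_of_mem_primeFactors hp).one_lt.le)
  -- the count with `P = {p}`
  have hcount := sum_matchWt_le hk N r hr hrN {p} (Finset.singleton_subset_iff.2 hp)
  rw [Finset.card_singleton, pow_one, Finset.sdiff_singleton_eq_erase] at hcount
  have hset : (dkBox L B R).filter (fun s => (∏ i, s i) = N ∧ ∀ q ∈ ({p} : Finset ℕ), ¬ Matched r s q) =
      S.filter (fun s => ¬ Matched r s p) := by
    rw [hS, Finset.filter_filter]
    refine Finset.filter_congr fun s _ => ?_
    simp only [Finset.mem_singleton, forall_eq]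
  rw [hset] at hcount
  calc Real.log p * ∑ s ∈ S.filter (fun s => ¬ Matched r s p), matchWt r s N
      ≤ Real.log p * (((k : ℝ) - 1) * ∏ q ∈ N.primeFactors.erase p, ((q : ℝ) + k - 2)) :=
        mul_le_mul_of_nonneg_left hcount hlogp
    _ = ((k : ℝ) - 1) * (Real.log p * ∏ q ∈ N.primeFactors.erase p, ((q : ℝ) + k - 2)) := by ring

/-! ### Regrouping by the mismatched prime `p` -/

/-- The modified weight `w(m) = ∏_{q∣m}(q + k − 2)/φ_ω(m)²` of the regrouped `E_diff` bound.
[cite: Maynard2016DenseClusters, proof of Prop. 9.1 p. 20 («Σ_r Y_r² φ(r)/φ_ω(r)² …»)] -/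
def wRatio (L : Fin k → ℤ × ℤ) (m : ℕ) : ℝ :=
  (∏ q ∈ m.primeFactors, ((q : ℝ) + k - 2)) / phiOmega L m ^ 2

/-- `w(m) ≥ 0` for `k ≥ 1`. [cite: Maynard2016DenseClusters, proof of Prop. 9.1 p. 20] -/
theorem wRatio_nonneg (hk : 1 ≤ k) (L : Fin k → ℤ × ℤ) (m : ℕ) : 0 ≤ wRatio L m := by
  unfold wRatio
  refine div_nonneg (Finset.prod_nonneg fun q hq => ?_) (sq_nonneg _)
  have h2 : (2 : ℝ) ≤ q := by exact_mod_cast (Nat.prime_of_mem_primeFactors hq).two_le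
  have h1 : (1 : ℝ) ≤ k := by exact_mod_cast hk
  linarith

/-- Peeling `p` in the weight: `∏_{q∣m, q≠p}(q+k−2)/φ_ω(m)² = w(m/p)/(p − ω(p))²`.
[cite: Maynard2016DenseClusters, proof of Prop. 9.1 p. 20; FordGreenKonyaginMaynardTao2018, §7 p. 21 (φ_ω multiplicative)] -/
theorem prod_erase_div_phiOmega_sq (L : Fin k → ℤ × ℤ) {m p : ℕ} (hm : Squarefree m) (hp : p.Prime)
    (hpm : p ∣ m) :
    (∏ q ∈ m.primeFactors.erase p, ((q : ℝ) + k - 2)) / phiOmega L m ^ 2 =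
      wRatio L (m / p) / ((p : ℝ) - omegaL L p) ^ 2 := by
  unfold wRatio
  rw [phiOmega_eq_mul_div L hm hp hpm, primeFactors_div_of_squarefree hm hp hpm, mul_pow, div_div,
    mul_comm]

/-- The primes that can occur in `𝒟_k(𝓛)`: `2k² < p ≤ ⌊R⌋`. [cite: Maynard2016DenseClusters, §7 p. 13] -/
def dkPrimes (k : ℕ) (R : ℝ) : Finset ℕ :=
  (Finset.Icc 1 ⌊R⌋₊).filter (fun p => p.Prime ∧ 2 * k ^ 2 < p)

/-- A prime factor of `∏rᵢ`, `r ∈ 𝒟_k(𝓛)`, lies in `dkPrimes`. [cite: Maynard2016DenseClusters, §7 p. 13] -/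
theorem mem_dkPrimes_of_mem_primeFactors {L : Fin k → ℤ × ℤ} {B : ℕ} {R : ℝ} {r : Fin k → ℕ}
    (hr : r ∈ dkBox L B R) {p : ℕ} (hp : p ∈ (∏ i, r i).primeFactors) : p ∈ dkPrimes k R := by
  have hpp := Nat.prime_of_mem_primeFactors hp
  have hpr := Nat.dvd_of_mem_primeFactors hp
  obtain ⟨i, -, hpi⟩ := ((Nat.prime_iff.1 hpp).dvd_finsetProd_iff _).1 hpr
  have hle : p ≤ ⌊R⌋₊ :=
    (Nat.le_of_dvd (one_le_of_mem_dkBox hr i) hpi).trans (le_floor_of_mem_dkBox hr i)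
  have hpW : ¬ p ∣ wCut k B * B := fun h =>
    hpp.one_lt.ne' (Nat.eq_one_of_dvd_coprimes (coprime_of_mem_dkBox hr) hpr h)
  unfold dkPrimes
  exact Finset.mem_filter.2 ⟨Finset.mem_Icc.2 ⟨hpp.one_lt.le, hle⟩, hpp,
    two_mul_sq_lt_of_not_dvd_wCut_mul hpp hpW⟩

/-- **Removing `p` from `rⱼ` (injection `r ↦ r/p@j`)**: `F₂(u(r)) ≤ F₂(u(r/p@j))` (`F₂` decreasing,
Lemma 8.6 / `F₂_anti`) and `∏(r/p@j) = ∏r/p`, so `Σ_{r ∈ 𝒟_k, p∣rⱼ} F₂(u(r))² w(∏r/p) ≤ Σ_{r' ∈ 𝒟_k} F₂(u(r'))² w(∏r')`.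
[cite: Maynard2016DenseClusters, proof of Prop. 9.1 p. 20 («letting r = r'p»), Lemma 8.2] -/
theorem sum_filter_dvd_F₂_sq_wRatio_le (hk : 2 ≤ k) {L : Fin k → ℤ × ℤ} {B : ℕ} {R : ℝ}
    (hR : 1 < R) {p : ℕ} (hp : p.Prime) (j : Fin k) :
    ∑ r ∈ (dkBox L B R).filter (fun r => p ∣ r j),
        MaynardDense.F₂ k (logVec R r) ^ 2 * wRatio L ((∏ i, r i) / p) ≤
      ∑ r ∈ dkBox L B R, MaynardDense.F₂ k (logVec R r) ^ 2 * wRatio L (∏ i, r i) := by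
  classical
  have hk1 : 1 ≤ k := le_trans (by norm_num) hk
  set φ : (Fin k → ℕ) → (Fin k → ℕ) := fun r => Function.update r j (r j / p) with hφ
  set g : (Fin k → ℕ) → ℝ := fun r => MaynardDense.F₂ k (logVec R r) ^ 2 * wRatio L (∏ i, r i)
    with hg
  -- pointwise comparison with the image point
  have hpt : ∀ r ∈ (dkBox L B R).filter (fun r => p ∣ r j),
      MaynardDense.F₂ k (logVec R r) ^ 2 * wRatio L ((∏ i, r i) / p) ≤ g (φ r) := by
    intro r hr
    obtain ⟨hrbox, hpj⟩ := Finset.mem_filter.1 hr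
    have hr' : φ r ∈ dkBox L B R := update_div_mem_dkBox hrbox j hpj
    have hprod : (∏ i, φ r i) = (∏ i, r i) / p :=
      (Nat.div_eq_of_eq_mul_right hp.pos (by rw [mul_prod_update_div r j hpj])).symm
    have hr1 : ∀ i, 1 ≤ r i := one_le_of_mem_dkBox hrbox
    have hr'1 : ∀ i, 1 ≤ φ r i := one_le_of_mem_dkBox hr'
    have hle : ∀ i, φ r i ≤ r i := by
      intro i
      by_cases hi : i = j
      · subst hi; simp only [hφ, Function.update_self]; exact Nat.div_le_self _ _
      · simp only [hφ, Function.update_of_ne hi]; exact le_rfl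
    have hanti : MaynardDense.F₂ k (logVec R r) ≤ MaynardDense.F₂ k (logVec R (φ r)) := by
      refine MaynardDense.F₂_anti hk (logVec_mem_orthant hR.le (φ r) hr'1) fun i => ?_
      unfold logVec
      exact div_le_div_of_nonneg_right (Real.log_le_log (by exact_mod_cast hr'1 i)
        (by exact_mod_cast hle i)) (Real.log_nonneg hR.le)
    have hF0 : 0 ≤ MaynardDense.F₂ k (logVec R r) :=
      MaynardDense.F₂_nonneg hk (logVec_mem_orthant hR.le r hr1)
    simp only [hg]
    rw [hprod]
    exact mul_le_mul_of_nonneg_right (pow_le_pow_left₀ hF0 hanti 2) (wRatio_nonneg hk1 L _)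
  have hinj : ∀ r ∈ (dkBox L B R).filter (fun r => p ∣ r j),
      ∀ t ∈ (dkBox L B R).filter (fun r => p ∣ r j), φ r = φ t → r = t := by
    intro r hr t ht hrt
    have hpr := (Finset.mem_filter.1 hr).2
    have hpt' := (Finset.mem_filter.1 ht).2
    have h1 : r = Function.update (φ r) j (φ r j * p) := by
      simp only [hφ]
      rw [Function.update_idem, Function.update_self, Nat.div_mul_cancel hpr, Function.update_eq_self]
    have h2 : t = Function.update (φ t) j (φ t j * p) := by
      simp only [hφ]
      rw [Function.update_idem, Function.update_self, Nat.div_mul_cancel hpt', Function.update_eq_self]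
    rw [h1, h2, hrt]
  have himg : ((dkBox L B R).filter (fun r => p ∣ r j)).image φ ⊆ dkBox L B R := by
    intro r' hr'
    obtain ⟨r, hr, rfl⟩ := Finset.mem_image.1 hr'
    obtain ⟨hrbox, hpj⟩ := Finset.mem_filter.1 hr
    exact update_div_mem_dkBox hrbox j hpj
  calc ∑ r ∈ (dkBox L B R).filter (fun r => p ∣ r j),
        MaynardDense.F₂ k (logVec R r) ^ 2 * wRatio L ((∏ i, r i) / p)
      ≤ ∑ r ∈ (dkBox L B R).filter (fun r => p ∣ r j), g (φ r) := Finset.sum_le_sum hpt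
    _ = ∑ r' ∈ ((dkBox L B R).filter (fun r => p ∣ r j)).image φ, g r' :=
        (Finset.sum_image hinj).symm
    _ ≤ ∑ r' ∈ dkBox L B R, g r' :=
        Finset.sum_le_sum_of_subset_of_nonneg himg fun r' _ _ =>
          mul_nonneg (sq_nonneg _) (wRatio_nonneg hk1 L _)

/-- For a prime `p` of `𝒟_k`: `log p/(p − ω(p))² ≤ 4 log p/p²` (`ω(p) ≤ k ≤ p/2`).
[cite: Maynard2016DenseClusters, proof of Prop. 9.1 p. 20 («Σ_{p>2k²} … log p/p²»)] -/
theorem log_div_sub_omegaL_sq_le {L : Fin k → ℤ × ℤ} (hadm : FormsAdmissible L) (hk : 1 ≤ k)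
    {R : ℝ} {p : ℕ} (hp : p ∈ dkPrimes k R) :
    Real.log p / ((p : ℝ) - omegaL L p) ^ 2 ≤ 4 * (Real.log p / (p : ℝ) ^ 2) := by
  obtain ⟨-, hpp, hkp⟩ := Finset.mem_filter.1 hp
  have hω : (omegaL L p : ℝ) ≤ k := by exact_mod_cast omegaL_le_card_of_admissible hadm hpp
  have hkp' : (2 : ℝ) * k ^ 2 < p := by exact_mod_cast hkp
  have hk1 : (1 : ℝ) ≤ k := by exact_mod_cast hk
  have hp0 : (0 : ℝ) < p := by exact_mod_cast hpp.pos
  have hlogp : 0 ≤ Real.log p := Real.log_nonneg (by exact_mod_cast hpp.one_lt.le)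
  have hhalf : (p : ℝ) / 2 ≤ (p : ℝ) - omegaL L p := by nlinarith
  have hpos : 0 < (p : ℝ) - omegaL L p := by linarith
  rw [← mul_div_assoc, div_le_div_iff₀ (pow_pos hpos 2) (pow_pos hp0 2)]
  have h4 : (p : ℝ) ^ 2 ≤ 4 * ((p : ℝ) - omegaL L p) ^ 2 := by nlinarith
  nlinarith

/-- **The regrouped bound**: `Σ_{r ∈ 𝒟_k} F₂(u(r))²/φ_ω(∏r)² · Σ_{s, ∏s=∏r} log A ∏_{q∣(r,s)}(q−1)
≤ 6 log 4 · Σ_{r ∈ 𝒟_k} F₂(u(r))² w(∏r)` — count (`sum_log_misProd_mul_matchWt_le`), regroup by the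
mismatched prime `p` (`r = r'p`, at most `k` positions, `F₂(u(r)) ≤ F₂(u(r'))`), `(p − ω(p))² ≥ p²/4` and the
Chebyshev tail `Σ_{p>2k²} log p/p² ≤ 3 log 4/(2k²)`.
[cite: Maynard2016DenseClusters, proof of Prop. 9.1 p. 20 («Σ_{p} (log p)/p² Σ_{r'} …», «≪ T_k Σ Y²/ (φ_ω log R)»)] -/
theorem sum_F₂_sq_kernel_le (hk : 2 ≤ k) {L : Fin k → ℤ × ℤ} (hadm : FormsAdmissible L) {B : ℕ}
    {R : ℝ} (hR : 1 < R) :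
    ∑ r ∈ dkBox L B R, MaynardDense.F₂ k (logVec R r) ^ 2 / phiOmega L (∏ i, r i) ^ 2 *
        ∑ s ∈ (dkBox L B R).filter (fun s => (∏ i, s i) = ∏ i, r i),
          Real.log (misProd r s (∏ i, r i)) * matchWt r s (∏ i, r i) ≤
      6 * Real.log 4 * ∑ r ∈ dkBox L B R, MaynardDense.F₂ k (logVec R r) ^ 2 * wRatio L (∏ i, r i) := by
  classical
  have hk1 : 1 ≤ k := le_trans (by norm_num) hk
  set D := dkBox L B R with hD
  set Sw := ∑ r ∈ D, MaynardDense.F₂ k (logVec R r) ^ 2 * wRatio L (∏ i, r i) with hSw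
  have hSw0 : 0 ≤ Sw := Finset.sum_nonneg fun r _ => mul_nonneg (sq_nonneg _) (wRatio_nonneg hk1 L _)
  set Fq : (Fin k → ℕ) → ℝ := fun r => MaynardDense.F₂ k (logVec R r) ^ 2 with hFq
  -- (1) per `r`: count and peel the weight
  have hper : ∀ r ∈ D, Fq r / phiOmega L (∏ i, r i) ^ 2 *
      ∑ s ∈ D.filter (fun s => (∏ i, s i) = ∏ i, r i),
        Real.log (misProd r s (∏ i, r i)) * matchWt r s (∏ i, r i) ≤
      ((k : ℝ) - 1) * ∑ p ∈ (∏ i, r i).primeFactors,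
        Real.log p / ((p : ℝ) - omegaL L p) ^ 2 * (Fq r * wRatio L ((∏ i, r i) / p)) := by
    intro r hr
    have hsq : Squarefree (∏ i, r i) := squarefree_of_mem_dkBox hr
    have hφ : 0 < phiOmega L (∏ i, r i) := phiOmega_prod_pos_of_mem_dkBox hadm hr
    have hcount := sum_log_misProd_mul_matchWt_le hk1 hr rfl
    have hFq0 : 0 ≤ Fq r / phiOmega L (∏ i, r i) ^ 2 := div_nonneg (sq_nonneg _) (sq_nonneg _)
    refine (mul_le_mul_of_nonneg_left hcount hFq0).trans (le_of_eq ?_)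
    rw [Finset.mul_sum, Finset.mul_sum, Finset.mul_sum]
    refine Finset.sum_congr rfl fun p hp => ?_
    have hpp := Nat.prime_of_mem_primeFactors hp
    have hpeel := prod_erase_div_phiOmega_sq L hsq hpp (Nat.dvd_of_mem_primeFactors hp)
    calc Fq r / phiOmega L (∏ i, r i) ^ 2 * (((k : ℝ) - 1) *
          (Real.log p * ∏ q ∈ (∏ i, r i).primeFactors.erase p, ((q : ℝ) + k - 2)))
        = ((k : ℝ) - 1) * (Real.log p * Fq r *
          ((∏ q ∈ (∏ i, r i).primeFactors.erase p, ((q : ℝ) + k - 2)) / phiOmega L (∏ i, r i) ^ 2)) := by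
          ring
      _ = ((k : ℝ) - 1) * (Real.log p / ((p : ℝ) - omegaL L p) ^ 2 * (Fq r * wRatio L ((∏ i, r i) / p))) := by
          rw [hpeel]; ring
  -- (2) swap `Σ_r Σ_{p ∣ ∏r}` into `Σ_{p} Σ_{r : p ∣ ∏r}`
  have hswap : ∑ r ∈ D, ∑ p ∈ (∏ i, r i).primeFactors,
      Real.log p / ((p : ℝ) - omegaL L p) ^ 2 * (Fq r * wRatio L ((∏ i, r i) / p)) =
      ∑ p ∈ dkPrimes k R, ∑ r ∈ D.filter (fun r => p ∈ (∏ i, r i).primeFactors),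
        Real.log p / ((p : ℝ) - omegaL L p) ^ 2 * (Fq r * wRatio L ((∏ i, r i) / p)) := by
    refine Finset.sum_comm' fun r p => ?_
    rw [Finset.mem_filter]
    constructor
    · rintro ⟨hr, hp⟩
      exact ⟨⟨hr, hp⟩, mem_dkPrimes_of_mem_primeFactors hr hp⟩
    · rintro ⟨⟨hr, hp⟩, -⟩
      exact ⟨hr, hp⟩
  -- (3) for fixed `p`: at most `k` positions, each fibre injects into `𝒟_k`
  have hfib : ∀ p ∈ dkPrimes k R,
      ∑ r ∈ D.filter (fun r => p ∈ (∏ i, r i).primeFactors), Fq r * wRatio L ((∏ i, r i) / p) ≤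
        k * Sw := by
    intro p hp
    have hpp : p.Prime := (Finset.mem_filter.1 hp).2.1
    have hnn : ∀ r, 0 ≤ Fq r * wRatio L ((∏ i, r i) / p) := fun r =>
      mul_nonneg (sq_nonneg _) (wRatio_nonneg hk1 L _)
    -- at least one position carries `p`
    have hone : ∀ r ∈ D.filter (fun r => p ∈ (∏ i, r i).primeFactors),
        Fq r * wRatio L ((∏ i, r i) / p) ≤
          ∑ j : Fin k, (if p ∣ r j then Fq r * wRatio L ((∏ i, r i) / p) else 0) := by
      intro r hr
      obtain ⟨-, hpmem⟩ := Finset.mem_filter.1 hr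
      obtain ⟨j₀, -, hj₀⟩ := ((Nat.prime_iff.1 hpp).dvd_finsetProd_iff _).1
        (Nat.dvd_of_mem_primeFactors hpmem)
      refine le_trans (le_of_eq (by rw [if_pos hj₀])) (Finset.single_le_sum (f := fun j =>
        if p ∣ r j then Fq r * wRatio L ((∏ i, r i) / p) else 0) (fun j _ => ?_) (Finset.mem_univ j₀))
      split_ifs
      · exact hnn r
      · exact le_rfl
    calc ∑ r ∈ D.filter (fun r => p ∈ (∏ i, r i).primeFactors), Fq r * wRatio L ((∏ i, r i) / p)
        ≤ ∑ r ∈ D.filter (fun r => p ∈ (∏ i, r i).primeFactors),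
            ∑ j : Fin k, (if p ∣ r j then Fq r * wRatio L ((∏ i, r i) / p) else 0) :=
          Finset.sum_le_sum hone
      _ = ∑ j : Fin k, ∑ r ∈ D.filter (fun r => p ∈ (∏ i, r i).primeFactors),
            (if p ∣ r j then Fq r * wRatio L ((∏ i, r i) / p) else 0) := Finset.sum_comm
      _ ≤ ∑ j : Fin k, ∑ r ∈ D.filter (fun r => p ∣ r j), Fq r * wRatio L ((∏ i, r i) / p) := by
          refine Finset.sum_le_sum fun j _ => ?_
          rw [← Finset.sum_filter]
          refine Finset.sum_le_sum_of_subset_of_nonneg (fun r hr => ?_) fun r _ _ => hnn r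
          obtain ⟨hr1, hpj⟩ := Finset.mem_filter.1 hr
          exact Finset.mem_filter.2 ⟨(Finset.mem_filter.1 hr1).1, hpj⟩
      _ ≤ ∑ j : Fin k, Sw := Finset.sum_le_sum fun j _ => sum_filter_dvd_F₂_sq_wRatio_le hk hR hpp j
      _ = k * Sw := by rw [Finset.sum_const, Finset.card_univ, Fintype.card_fin, nsmul_eq_mul]
  -- (4) the prime tail
  have htail : ∑ p ∈ dkPrimes k R, Real.log p / (p : ℝ) ^ 2 ≤ 3 * Real.log 4 / (2 * k ^ 2 : ℕ) := by
    have h2 : 2 ≤ 2 * k ^ 2 := by nlinarith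
    have h := MaynardDense.sum_filter_prime_gt_log_div_sq_le h2 (Finset.Icc 1 ⌊R⌋₊)
    exact h
  have hk0 : (0 : ℝ) < k := by exact_mod_cast lt_of_lt_of_le (by norm_num) hk
  have hkm1 : (0 : ℝ) ≤ (k : ℝ) - 1 := by
    have : (1 : ℝ) ≤ k := by exact_mod_cast hk1
    linarith
  -- assemble
  calc ∑ r ∈ D, Fq r / phiOmega L (∏ i, r i) ^ 2 *
        ∑ s ∈ D.filter (fun s => (∏ i, s i) = ∏ i, r i),
          Real.log (misProd r s (∏ i, r i)) * matchWt r s (∏ i, r i)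
      ≤ ∑ r ∈ D, ((k : ℝ) - 1) * ∑ p ∈ (∏ i, r i).primeFactors,
          Real.log p / ((p : ℝ) - omegaL L p) ^ 2 * (Fq r * wRatio L ((∏ i, r i) / p)) :=
        Finset.sum_le_sum hper
    _ = ((k : ℝ) - 1) * ∑ p ∈ dkPrimes k R, ∑ r ∈ D.filter (fun r => p ∈ (∏ i, r i).primeFactors),
          Real.log p / ((p : ℝ) - omegaL L p) ^ 2 * (Fq r * wRatio L ((∏ i, r i) / p)) := by
        rw [← Finset.mul_sum, hswap]
    _ = ((k : ℝ) - 1) * ∑ p ∈ dkPrimes k R, Real.log p / ((p : ℝ) - omegaL L p) ^ 2 *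
          ∑ r ∈ D.filter (fun r => p ∈ (∏ i, r i).primeFactors), Fq r * wRatio L ((∏ i, r i) / p) := by
        congr 1
        refine Finset.sum_congr rfl fun p _ => ?_
        rw [Finset.mul_sum]
    _ ≤ ((k : ℝ) - 1) * ∑ p ∈ dkPrimes k R, (4 * (Real.log p / (p : ℝ) ^ 2)) * (k * Sw) := by
        refine mul_le_mul_of_nonneg_left (Finset.sum_le_sum fun p hp => ?_) hkm1
        have hlp : 0 ≤ Real.log p / ((p : ℝ) - omegaL L p) ^ 2 :=
          div_nonneg (Real.log_nonneg (by exact_mod_cast (Finset.mem_filter.1 hp).2.1.one_lt.le))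
            (sq_nonneg _)
        exact mul_le_mul (log_div_sub_omegaL_sq_le hadm hk1 hp) (hfib p hp)
          (Finset.sum_nonneg fun r _ => mul_nonneg (sq_nonneg _) (wRatio_nonneg hk1 L _))
          (by positivity)
    _ = 4 * ((k : ℝ) - 1) * k * Sw * ∑ p ∈ dkPrimes k R, Real.log p / (p : ℝ) ^ 2 := by
        rw [← Finset.sum_mul, ← Finset.mul_sum]; ring
    _ ≤ 4 * ((k : ℝ) - 1) * k * Sw * (3 * Real.log 4 / (2 * k ^ 2 : ℕ)) :=
        mul_le_mul_of_nonneg_left htail (by positivity)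
    _ ≤ 6 * Real.log 4 * Sw := by
        have hlog4 : 0 < Real.log 4 := Real.log_pos (by norm_num)
        push_cast
        have h1 : 4 * ((k : ℝ) - 1) * k * Sw * (3 * Real.log 4 / (2 * (k : ℝ) ^ 2)) =
            6 * Real.log 4 * Sw * (((k : ℝ) - 1) / k) := by
          field_simp
          ring
        rw [h1]
        have h2 : ((k : ℝ) - 1) / k ≤ 1 := by
          rw [div_le_one hk0]; linarith
        calc 6 * Real.log 4 * Sw * (((k : ℝ) - 1) / k) ≤ 6 * Real.log 4 * Sw * 1 :=
              mul_le_mul_of_nonneg_left h2 (by positivity)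
          _ = 6 * Real.log 4 * Sw := mul_one _

/-- **`E_diff` reduced to one `k`-fold sum** (everything in the printed proof up to the appeal to
Lemma 8.4/8.3): for `r, s` over `𝒟_k(𝓛)`,
`|Σ_{r,s} y_r(y_s − y_r) T(r,s)/φ_ω(∏r)²| ≤ 12 log 4 · (30 + 30/U_k + T_k) P²/(k log R) · Σ_{r ∈ 𝒟_k} F₂(u(r))² w(∏r)`
with `w(m) = ∏_{q∣m}(q+k−2)/φ_ω(m)²`. The remaining input is the upper bound
`Σ_r F₂(u(r))² w(∏r) ≪ P⁻¹ (log R)^k k γ_{h}γ^{k−1}` (k one-dimensional sums, Lemma 8.3).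
[cite: Maynard2016DenseClusters, proof of Prop. 9.1 pp. 19–20 («≪ T_k/(log R) Σ_{r} Y_r²/φ_ω(r) … which is k T_k/log R times the main term»); FordGreenKonyaginMaynardTao2018, Theorem 6 (7.12) p. 21] -/
theorem abs_ediff_le_sum_F₂_sq_wRatio {L : Fin k → ℤ × ℤ} (hadm : FormsAdmissible L)
    (hnd : FormsNondegenerate L) (hk : 2 ≤ k) {B : ℕ} (hB : B ≠ 0) {R : ℝ} (hR : 1 < R) :
    |∑ r ∈ dkBox L B R, ∑ s ∈ dkBox L B R,
        yVar L B R (MaynardDense.F k) r *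
            (yVar L B R (MaynardDense.F k) s - yVar L B R (MaynardDense.F k) r) /
          phiOmega L (∏ i, r i) ^ 2 * localPairSum L B R r s| ≤
      12 * Real.log 4 *
        ((30 + 30 / MaynardDense.U k + MaynardDense.T k) * yPref L B ^ 2 / (k * Real.log R)) *
        ∑ r ∈ dkBox L B R, MaynardDense.F₂ k (logVec R r) ^ 2 * wRatio L (∏ i, r i) := by
  have h1 := abs_ediff_le_sum_kernel hadm hnd hk hB hR
  have h2 := sum_F₂_sq_kernel_le hk hadm (B := B) hR
  have hC : 0 ≤ (30 + 30 / MaynardDense.U k + MaynardDense.T k) * yPref L B ^ 2 / (k * Real.log R) := by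
    have hU : 0 < MaynardDense.U k := by unfold MaynardDense.U; positivity
    have := MaynardDense.T_pos hk
    have hlogR : 0 < Real.log R := Real.log_pos hR
    positivity
  refine h1.trans ?_
  calc 2 * ((30 + 30 / MaynardDense.U k + MaynardDense.T k) * yPref L B ^ 2 / (k * Real.log R)) *
        ∑ r ∈ dkBox L B R, MaynardDense.F₂ k (logVec R r) ^ 2 / phiOmega L (∏ i, r i) ^ 2 *
          ∑ s ∈ (dkBox L B R).filter (fun s => (∏ i, s i) = ∏ i, r i),
            Real.log (misProd r s (∏ i, r i)) * matchWt r s (∏ i, r i)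
      ≤ 2 * ((30 + 30 / MaynardDense.U k + MaynardDense.T k) * yPref L B ^ 2 / (k * Real.log R)) *
        (6 * Real.log 4 * ∑ r ∈ dkBox L B R, MaynardDense.F₂ k (logVec R r) ^ 2 * wRatio L (∏ i, r i)) :=
        mul_le_mul_of_nonneg_left h2 (by positivity)
    _ = _ := by ring

end Literature.NumberTheory.Sieve.FGKMT2018
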